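import Summits.CriticalPhenomena.PercolationContinuityZ3.Theorems.PercNearOneGluingNoHeavyLowerTailKnQuestion8CoefficientwiseCoreClassOneSidedRootCore
import HarnessLib

/-!
# THEOREM OSR-Θ: the one-sided root inequality for bundles, and KB-SERIES for bundle blocks (`Θ · Θ′`)

Support file (`--supports stmt-CriticalPhenomena-4575`, closed), prover `prim-cplus-coupling` (gen 33).  No definitions, no named facts, no sorries;
standard axioms.  Memo `prim-cplus-coupling/A5-COUPLING-gen33.md` §1–§2.  On top of `…CoreClassOneSidedRootCore` (the induction) and
`…CoreClassSeriesMain` / `…CoreClassSeriesAdj` (THEOREM KB-SERIES ⟸ OSR) / `…CoreClassDomBundle` (internal degree `≤ 2` ⟹ pocket-free).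

* `Coefficientwise.oneSidedRoot_of_degLeTwo` — **THEOREM OSR-Θ.**  Let `E₁` be an edge set without loops in which every vertex other than `c, a` lies
  on at most two edges (every bundle `Θ(k₁,…,k_r)` of internally disjoint `c–a` threads, with or without the edge `ca`, together with any ears and
  pendant paths at `c`, anything attached at `a` alone, and components missing `c, a`).  Then for all monotone `H ≥ Hᵇ`, `K ≥ Kᵇ`:
  `0 ≤ Σ_{ω ⊆ E₁ : a ∈ C_c ω ∖ C_c(E₁∖ω)} (H(C_c ω) − Hᵇ(C_c(E₁∖ω)))(K(C_c ω) − Kᵇ(C_c(E₁∖ω)))` — the hypothesis `OSR(E₁; c, a)` of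
  `coreClass_kernelMixFull_series` / `cwpa_coreClass_of_series`.  (The memo's census: OSR holds on all graphs with `≤ 7` vertices, fails for two rooted
  graphs on `8` vertices with a vertex of degree `3`; so the degree hypothesis is where the theorem lives.)
* `Coefficientwise.cwpa_coreClass_of_series_degLeTwo_pocketFree` — **KB-SERIES for a bundle block**: CW-PA (all monotone `f, g`) on the core class
  `N(x) = N(z) = {a, b}` over `E₁ ·_c E₂` with `(E₁; c, a)` of internal degree `≤ 2` and `(E₂; c, b)` pocket-free.
* `Coefficientwise.cwpa_coreClass_of_series_degLeTwo_degLeTwo` — both blocks of internal degree `≤ 2`: every `Θ(k₁,…,k_r) ·_c Θ(l₁,…,l_s)`, in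
  particular `Θ(1,3)·Θ(1,3)` — the 48 taut 7-vertex middles without a proper domination map (memo gen 31 §3.2) — with pendant paths at the terminals
  by `…CoreClassSeriesLeaf`.
[cite: KozmaNitzan2024, Questions 8–9 (§5.5 p. 36) (context: the Question-8 pocket covariance programme)]
-/

namespace Summit.CriticalPhenomena.PercolationContinuityZ3.Theorems

open Finset Literature.Probability.Percolation
open scoped symmDiff

namespace Coefficientwise

variable {ι V : Type*}

open Classical in
/-- **THEOREM OSR-Θ (the one-sided root inequality for bundles).**  `E₁` without loops, every vertex `∉ {c, a}` on at most two edges of `E₁`, `c ≠ a`.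
Then for all monotone `H, Hᵇ, K, Kᵇ` with `Hᵇ ≤ H`, `Kᵇ ≤ K`:
`0 ≤ Σ_{ω₁ ⊆ E₁ : a ∈ C_c ω₁, a ∉ C_c(E₁∖ω₁)} (H(C_c ω₁) − Hᵇ(C_c(E₁∖ω₁)))(K(C_c ω₁) − Kᵇ(C_c(E₁∖ω₁)))`.
[cite: KozmaNitzan2024, Questions 8–9 (§5.5 p. 36) (context)] -/
theorem oneSidedRoot_of_degLeTwo (ends : ι → Sym2 V) (E₁ : Finset ι) (c a : V) (hca : c ≠ a)
    (hloop : ∀ i ∈ E₁, ¬ (ends i).IsDiag)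
    (hdeg : ∀ u, u ≠ c → u ≠ a → ∀ i j k, i ∈ E₁ → j ∈ E₁ → k ∈ E₁ → u ∈ ends i → u ∈ ends j → u ∈ ends k → i = j ∨ i = k ∨ j = k)
    (H Hb K Kb : Set V → ℝ) (hH : Monotone H) (hHb : Monotone Hb) (hK : Monotone K) (hKb : Monotone Kb)
    (hHbH : ∀ X, Hb X ≤ H X) (hKbK : ∀ X, Kb X ≤ K X) :
    0 ≤ ∑ ω₁ ∈ E₁.powerset, (if a ∈ openCluster (ends '' (↑ω₁ : Set ι)) c ∧ a ∉ openCluster (ends '' (↑(E₁ \ ω₁) : Set ι)) c then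
        (H (openCluster (ends '' (↑ω₁ : Set ι)) c) - Hb (openCluster (ends '' (↑(E₁ \ ω₁) : Set ι)) c)) *
          (K (openCluster (ends '' (↑ω₁ : Set ι)) c) - Kb (openCluster (ends '' (↑(E₁ \ ω₁) : Set ι)) c)) else 0) := by
  have key := osr_degLeTwo_core ends c a hca (2 * E₁.card) E₁ ∅ ∅ ∅ c (by simp) hloop hdeg (Finset.empty_subset _)
    (fun u _ _ i hi => absurd hi (Finset.notMem_empty i)) (Finset.empty_subset _) (fun i hi => absurd hi (Finset.notMem_empty i))
    (fun i hi => absurd hi (Finset.notMem_empty i)) (fun x hx => absurd hx (Set.notMem_empty x)) (mem_openCluster_self _ _)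
    (fun x hx => absurd hx (Set.notMem_empty x)) (fun i _ _ x hx => absurd hx (Set.notMem_empty x))
    (fun hx => absurd hx (Set.notMem_empty c)) (Or.inr (Or.inl rfl)) H Hb K Kb hH hHb hK hKb hHbH hKbK
  rw [sum_ite_congr_prop E₁.powerset _ (fun ω => (∅ : Finset ι) ⊆ ω ∧ ((∅ : Finset ι) ⊆ ω ∨ Disjoint (∅ : Finset ι) ω) ∧
      a ∈ openCluster (ends '' (↑ω : Set ι)) c ∧ a ∉ openCluster (ends '' (↑(E₁ \ ω) : Set ι)) c) _ ?_]
  · exact key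
  · intro ω _
    constructor
    · intro h; exact ⟨Finset.empty_subset _, Or.inl (Finset.empty_subset _), h⟩
    · intro h; exact h.2.2

open Classical in
/-- **KB-SERIES for a bundle block: `(E₁; c, a)` of internal degree ≤ 2, `(E₂; c, b)` pocket-free.**  Core-class bookkeeping for `E_H = E₁ ∪ E₂` as in
`cwpa_coreClass_of_series`; `E₁` has no loops and every vertex `∉ {c, a}` lies on at most two of its edges (so `(E₁; a, c)` carries the proper domination
map `R_A` by `pocketFree_of_deg_le_two`, and `OSR(E₁; c, a)` holds by THEOREM OSR-Θ); `(E₂; c, b)` is pocket-free.  Then CW-PA holds on the core class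
`N(x) = N(z) = {a, b}` over `E₁ ∪ E₂` for all monotone `f, g`. [cite: KozmaNitzan2024, Questions 8–9 (§5.5 p. 36) (context)] -/
theorem cwpa_coreClass_of_series_degLeTwo_pocketFree (ends : ι → Sym2 V) (E₁ E₂ E₀ : Finset ι) (x z c a b : V) (ixa ixb iza izb : ι)
    (hdisj : Disjoint E₁ E₂) (hsep : ∀ i ∈ E₁, ∀ j ∈ E₂, ∀ u, u ∈ ends i → u ∈ ends j → u = c)
    (haE : ∀ j ∈ E₂, a ∉ ends j) (hbE : ∀ i ∈ E₁, b ∉ ends i) (hba : b ≠ a) (hca : c ≠ a)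
    (hxa : ends ixa = s(x, a)) (hxb : ends ixb = s(x, b)) (hza : ends iza = s(z, a)) (hzb : ends izb = s(z, b))
    (hH : ∀ i ∈ E₁ ∪ E₂, x ∉ ends i ∧ z ∉ ends i) (hE₀ : ∀ i, i ∈ E₀ ↔ i ∈ E₁ ∪ E₂ ∨ i = ixa ∨ i = ixb ∨ i = iza ∨ i = izb)
    (hnot : ixa ∉ E₁ ∪ E₂ ∧ ixb ∉ E₁ ∪ E₂ ∧ iza ∉ E₁ ∪ E₂ ∧ izb ∉ E₁ ∪ E₂)
    (hd : ixa ≠ ixb ∧ ixa ≠ iza ∧ ixa ≠ izb ∧ ixb ≠ iza ∧ ixb ≠ izb ∧ iza ≠ izb)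
    (hxz : x ≠ z) (hxa' : x ≠ a) (hxb' : x ≠ b) (hza' : z ≠ a) (hzb' : z ≠ b)
    (hloop₁ : ∀ i ∈ E₁, ¬ (ends i).IsDiag)
    (hdeg₁ : ∀ u, u ≠ c → u ≠ a → ∀ i j l, i ∈ E₁ → j ∈ E₁ → l ∈ E₁ → u ∈ ends i → u ∈ ends j → u ∈ ends l → i = j ∨ i = l ∨ j = l)
    (hpf : ∀ ω, ω ⊆ E₂ → b ∉ openCluster (ends '' (↑ω : Set ι)) c → b ∉ openCluster (ends '' (↑(E₂ \ ω) : Set ι)) c →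
      openCluster (ends '' (↑(E₂ \ ω) : Set ι)) b ⊆ openCluster (ends '' (↑ω : Set ι)) c ∪
        openCluster (ends '' (↑((E₂ \ ω).filter (fun i => ∀ v, v ∈ ends i → v ∉ openCluster (ends '' (↑ω : Set ι)) c)) : Set ι)) b)
    (f g : Set V → ℝ) (hf : Monotone f) (hg : Monotone g) :
    0 ≤ ∑ s ∈ E₀.powerset.filter (fun s : Finset ι => z ∉ openCluster (ends '' (↑s : Set ι)) x ∧ z ∉ openCluster (ends '' (↑(E₀ \ s) : Set ι)) x),
      f (openCluster (ends '' (↑s : Set ι)) x) * (g (openCluster (ends '' (↑s : Set ι)) x) - g (openCluster (ends '' (↑(E₀ \ s) : Set ι)) x)) := by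
  -- pocket-freeness of (E₁; a, c) from the degree hypothesis
  have hdeg₁' : ∀ u, u ≠ a → u ≠ c → ∀ i j l, i ∈ E₁ → j ∈ E₁ → l ∈ E₁ → u ∈ ends i → u ∈ ends j → u ∈ ends l → i = j ∨ i = l ∨ j = l :=
    fun u hua huc => hdeg₁ u huc hua
  have hpf₁ : ∀ ω, ω ⊆ E₁ → c ∉ openCluster (ends '' (↑ω : Set ι)) a → c ∉ openCluster (ends '' (↑(E₁ \ ω) : Set ι)) a →
      openCluster (ends '' (↑(E₁ \ ω) : Set ι)) c ⊆ openCluster (ends '' (↑ω : Set ι)) a ∪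
        openCluster (ends '' (↑((E₁ \ ω).filter (fun i => ∀ v, v ∈ ends i → v ∉ openCluster (ends '' (↑ω : Set ι)) a)) : Set ι)) c :=
    fun ω hω hcR hcB => pocketFree_of_deg_le_two ends E₁ a c hdeg₁' ω hω hcR (fun h => hcB ((mem_openCluster_comm ends (E₁ \ ω) a c).mpr h))
  refine cwpa_coreClass_of_series ends E₁ E₂ E₀ x z c a b ixa ixb iza izb hdisj hsep haE hbE hba hxa hxb hza hzb hH hE₀ hnot hd hxz hxa' hxb' hza' hzb'
    (fun ω => ω ∆ E₁.filter (fun i => ∀ v, v ∈ ends i → v ∉ openCluster (ends '' (↑ω : Set ι)) a)) ?_ ?_ ?_ ?_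
    (fun ω => ω ∆ E₂.filter (fun i => ∀ v, v ∈ ends i → v ∉ openCluster (ends '' (↑ω : Set ι)) c)) ?_ ?_ ?_ ?_
    (fun H Hb K Kb hH' hHb' hK' hKb' _ hHb _ hKb => oneSidedRoot_of_degLeTwo ends E₁ c a hca hloop₁ hdeg₁ H Hb K Kb hH' hHb' hK' hKb' hHb hKb)
    f g hf hg
  · intro ω hω _ _ i hi
    rw [Finset.mem_symmDiff, Finset.mem_filter] at hi
    rcases hi with ⟨hi', _⟩ | ⟨hi', _⟩
    · exact hω hi'
    · exact hi'.1
  · intro ω hω hcR hcB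
    rw [openCluster_toggleOff_eq ends E₁ ω a]
    intro y hy
    rcases hy with hy | hy
    · exact Or.inl hy
    · rcases hpf₁ ω hω hcR hcB hy with hy' | hy'
      · exact Or.inl hy'
      · exact Or.inr (openCluster_sdiff_off_subset_toggleOff ends E₁ ω a c hy')
  · intro ω₁ ω₂ _ _ _ _ _ _ heq
    have h1 := toggleOff_toggleOff ends E₁ ω₁ a
    have h2 := toggleOff_toggleOff ends E₁ ω₂ a
    beta_reduce at h1 h2
    rw [← h1, ← h2, heq]
  · intro ω _ hcR _
    rw [openCluster_toggleOff_eq ends E₁ ω a]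
    exact hcR
  · intro ω hω _ _ i hi
    rw [Finset.mem_symmDiff, Finset.mem_filter] at hi
    rcases hi with ⟨hi', _⟩ | ⟨hi', _⟩
    · exact hω hi'
    · exact hi'.1
  · intro ω hω hbR hbB
    rw [openCluster_toggleOff_eq ends E₂ ω c]
    intro y hy
    rcases hy with hy | hy
    · exact Or.inl hy
    · rcases hpf ω hω hbR hbB hy with hy' | hy'
      · exact Or.inl hy'
      · exact Or.inr (openCluster_sdiff_off_subset_toggleOff ends E₂ ω c b hy')
  · intro ω₁ ω₂ _ _ _ _ _ _ heq
    have h1 := toggleOff_toggleOff ends E₂ ω₁ c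
    have h2 := toggleOff_toggleOff ends E₂ ω₂ c
    beta_reduce at h1 h2
    rw [← h1, ← h2, heq]
  · intro ω _ hbR _
    rw [openCluster_toggleOff_eq ends E₂ ω c]
    exact hbR

open Classical in
/-- **KB-SERIES for two bundle blocks (`Θ · Θ′`).**  As `cwpa_coreClass_of_series_degLeTwo_pocketFree` with `(E₂; c, b)` also of internal degree ≤ 2:
every series composition `Θ(k₁,…,k_r) ·_c Θ(l₁,…,l_s)` of thread bundles (e.g. `Θ(1,3)·Θ(1,3)`, two diamonds glued at a vertex with the terminals in
different diamonds — outside the reach of proper domination maps).  CW-PA holds on the core class over `E₁ ∪ E₂` for all monotone `f, g`.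
[cite: KozmaNitzan2024, Questions 8–9 (§5.5 p. 36) (context)] -/
theorem cwpa_coreClass_of_series_degLeTwo_degLeTwo (ends : ι → Sym2 V) (E₁ E₂ E₀ : Finset ι) (x z c a b : V) (ixa ixb iza izb : ι)
    (hdisj : Disjoint E₁ E₂) (hsep : ∀ i ∈ E₁, ∀ j ∈ E₂, ∀ u, u ∈ ends i → u ∈ ends j → u = c)
    (haE : ∀ j ∈ E₂, a ∉ ends j) (hbE : ∀ i ∈ E₁, b ∉ ends i) (hba : b ≠ a) (hca : c ≠ a)
    (hxa : ends ixa = s(x, a)) (hxb : ends ixb = s(x, b)) (hza : ends iza = s(z, a)) (hzb : ends izb = s(z, b))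
    (hH : ∀ i ∈ E₁ ∪ E₂, x ∉ ends i ∧ z ∉ ends i) (hE₀ : ∀ i, i ∈ E₀ ↔ i ∈ E₁ ∪ E₂ ∨ i = ixa ∨ i = ixb ∨ i = iza ∨ i = izb)
    (hnot : ixa ∉ E₁ ∪ E₂ ∧ ixb ∉ E₁ ∪ E₂ ∧ iza ∉ E₁ ∪ E₂ ∧ izb ∉ E₁ ∪ E₂)
    (hd : ixa ≠ ixb ∧ ixa ≠ iza ∧ ixa ≠ izb ∧ ixb ≠ iza ∧ ixb ≠ izb ∧ iza ≠ izb)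
    (hxz : x ≠ z) (hxa' : x ≠ a) (hxb' : x ≠ b) (hza' : z ≠ a) (hzb' : z ≠ b)
    (hloop₁ : ∀ i ∈ E₁, ¬ (ends i).IsDiag)
    (hdeg₁ : ∀ u, u ≠ c → u ≠ a → ∀ i j l, i ∈ E₁ → j ∈ E₁ → l ∈ E₁ → u ∈ ends i → u ∈ ends j → u ∈ ends l → i = j ∨ i = l ∨ j = l)
    (hdeg₂ : ∀ u, u ≠ c → u ≠ b → ∀ i j l, i ∈ E₂ → j ∈ E₂ → l ∈ E₂ → u ∈ ends i → u ∈ ends j → u ∈ ends l → i = j ∨ i = l ∨ j = l)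
    (f g : Set V → ℝ) (hf : Monotone f) (hg : Monotone g) :
    0 ≤ ∑ s ∈ E₀.powerset.filter (fun s : Finset ι => z ∉ openCluster (ends '' (↑s : Set ι)) x ∧ z ∉ openCluster (ends '' (↑(E₀ \ s) : Set ι)) x),
      f (openCluster (ends '' (↑s : Set ι)) x) * (g (openCluster (ends '' (↑s : Set ι)) x) - g (openCluster (ends '' (↑(E₀ \ s) : Set ι)) x)) := by
  refine cwpa_coreClass_of_series_degLeTwo_pocketFree ends E₁ E₂ E₀ x z c a b ixa ixb iza izb hdisj hsep haE hbE hba hca hxa hxb hza hzb hH hE₀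
    hnot hd hxz hxa' hxb' hza' hzb' hloop₁ hdeg₁ ?_ f g hf hg
  intro ω hω hbR hbB
  exact pocketFree_of_deg_le_two ends E₂ c b hdeg₂ ω hω hbR (fun hx => hbB ((mem_openCluster_comm ends (E₂ \ ω) c b).mpr hx))

end Coefficientwise

end Summit.CriticalPhenomena.PercolationContinuityZ3.Theorems
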